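/-
Copyright: statement-level skeleton of a published paper (lit-balaban cell, Phase-2 proof seat p19, gen 2). No claims beyond
what the kernel checks below.
-/
import Mathlib
import Literature.MathematicalPhysics.QuantumFieldTheory.Balaban1983to89.B3Ineq215CubeGeometry
import Literature.MathematicalPhysics.QuantumFieldTheory.Balaban1983to89.B3Ineq215Quotient

/-!
# B3 — T. Bałaban, *(Higgs)₂,₃ quantum fields in a finite volume. III. Renormalization*, CMP **88** (1983) 411–445
[Balaban1983Higgs3] — Sect. 2, pp. 427–428: how the quotient graph `G/G_i`, its degrees and its weight (2.14) change when
the line l(i+1) is shrunk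

statement-level skeleton of published theorems with citation tags; proofs where landed; nothing here is a claim about
the Yang–Mills mass gap

PDF held: `paper:balaban1983-higgs-2-3-quantum-fields-finite-volume` (journal page = PDF page + 410); displays read on
the ×2 renders `pub-balaban/b2b-balaban-ref1/pages/1983-cmp88-higgs23-III/1983-cmp88-higgs23-III-p014 … p018-x2.png`
(pp. 424–428).

Part of the Phase-2 proof of SKELETON rows **B3.Eq2.15-2.16** (unit `lit-balaban-p19` gen 2, HOME
`run/shared/lean/pub/lit-balaban/`): files `B3Ineq215CubeGeometry` → `B3Ineq215DecaySum`, `B3Ineq215Quotient` →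
`B3Ineq215Degrees` → `B3Ineq215Reroute` → `B3Ineq215Step` → `B3Ineq215Proof` (the theorem `Model.ineq215`), all in the
sub-namespace `…Balaban1983to89.B3Ineq215`; the rows were typed by r15 in `B3Sect2FirstEstimate`.

WHAT IS REPRODUCED (continuation of `B3Ineq215Quotient`).  KERNEL-CHECKED bookkeeping of the shrinking of l(i+1)
(p. 427: *"After this shrinking the graph G₁ becomes a new vertex v₁ with the same external legs as the graph G₁"*;
p. 428: *"A graph G/G_i is defined as a graph obtained from G by shrinking all connected components G_i^{(α)} of G_i to
points"*): the merged block and its lines (`fiber_succ_bs`, `before_succ_bs`), the other blocks unchanged, and the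
exponent identity behind *"the remaining powers of L^jη connected with the graph G₁ give us (L^jη)^{D(G₁)}"* —
`Model.Dsum_succ`: shrinking l(i+1) raises `Σ_α D(G_i^{(α)})` by `a_{l(i+1)} + e(b_s) + [d + e(b_t)]` (the bracket only when
the endpoints lie in different blocks); `Model.Dsum_succ_pos`: if every component of `G_{i+1}` has positive degree then
`Σ_α D(G_{i+1}^{(α)}) > 0`; how the lowest index `j(v)` changes (`low_bs`, `low_bt`, `le_low_succ`).  Then the DEFINITIONS
of the weight (2.14) p. 427 of `G/G_i` on the concrete cubes of `B3Ineq215CubeGeometry` (`VF`, `LP`, `lineF`, `EXP`,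
`Locs`, `W`; decay rates `δ_i = δ₀/(2m+1)^i`).  Nothing of the paper is asserted.
-/

open Finset

namespace Literature.MathematicalPhysics.QuantumFieldTheory.Balaban1983to89.B3Ineq215

namespace Model

variable {V : Type} [Fintype V] [DecidableEq V] {m : ℕ} (M : Model V m)

/-! ### How blocks, lines and degrees change when l(i+1) is shrunk -/

section Succ

variable {i : ℕ} (h : i < m)

/-- The merged block. [cite: Balaban1983Higgs3, (2.16) p.428] -/
theorem fiber_succ_bs : M.fiber (i + 1) (M.bs i h) = M.fiber i (M.bs i h) ∪ M.fiber i (M.bt i h) := by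
  ext v
  rw [Finset.mem_union, M.mem_fiber, M.mem_fiber, M.mem_fiber, M.rep_succ h]
  unfold rho
  split_ifs with h'
  · simp [h']
  · simp [h']

/-- Other blocks are unchanged. [cite: Balaban1983Higgs3, (2.16) p.428] -/
theorem fiber_succ_of_ne {b : V} (hb1 : b ≠ M.bs i h) (hb2 : b ≠ M.bt i h) : M.fiber (i + 1) b = M.fiber i b := by
  ext v
  rw [M.mem_fiber, M.mem_fiber, M.rep_succ h]
  unfold rho
  split_ifs with h'
  · exact ⟨fun e => absurd e.symm hb1, fun e => absurd (h'.symm.trans e) hb2.symm⟩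
  · exact Iff.rfl

/-- The lines of the merged block: those of the two blocks and l(i+1). [cite: Balaban1983Higgs3, (2.16) p.428] -/
theorem before_succ_bs :
    M.before (i + 1) (M.bs i h) = insert ⟨i, h⟩ (M.before i (M.bs i h) ∪ M.before i (M.bt i h)) := by
  ext l
  rw [Finset.mem_insert, Finset.mem_union, M.mem_before, M.mem_before, M.mem_before, M.rep_succ h]
  constructor
  · rintro ⟨hl, hr⟩
    by_cases hli : (l : ℕ) = i
    · exact Or.inl (Fin.ext hli)
    · have hl' : (l : ℕ) < i := by omega
      right
      unfold rho at hr
      split_ifs at hr with h'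
      · exact Or.inr ⟨hl', h'⟩
      · exact Or.inl ⟨hl', hr⟩
  · rintro (rfl | ⟨hl, hr⟩ | ⟨hl, hr⟩)
    · exact ⟨Nat.lt_succ_self i, M.rho_bs h⟩
    · exact ⟨Nat.lt_succ_of_lt hl, by rw [hr, M.rho_bs h]⟩
    · exact ⟨Nat.lt_succ_of_lt hl, by rw [hr, M.rho_bt h]⟩

/-- Other blocks keep their lines. [cite: Balaban1983Higgs3, (2.16) p.428] -/
theorem before_succ_of_ne {b : V} (hb1 : b ≠ M.bs i h) (hb2 : b ≠ M.bt i h) : M.before (i + 1) b = M.before i b := by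
  ext l
  rw [M.mem_before, M.mem_before, M.rep_succ h]
  constructor
  · rintro ⟨hl, hr⟩
    have hr' : M.rep i (M.src l) = b := by
      unfold rho at hr; split_ifs at hr with h'
      · exact absurd hr.symm hb1
      · exact hr
    refine ⟨?_, hr'⟩
    rcases Nat.lt_succ_iff_lt_or_eq.1 hl with hlt | heq
    · exact hlt
    · exfalso
      have : l = ⟨i, h⟩ := Fin.ext heq
      subst this
      exact hb1 hr'.symm
  · rintro ⟨hl, hr⟩
    refine ⟨Nat.lt_succ_of_lt hl, ?_⟩
    rw [hr, M.rho_of_ne h hb2]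

/-- l(i+1) is not a line of any block of `G_i`. [cite: Balaban1983Higgs3, (2.16) p.428] -/
theorem not_mem_before (b : V) : (⟨i, h⟩ : Fin m) ∉ M.before i b := by
  simp [M.mem_before]

/-- Different blocks are disjoint. [cite: Balaban1983Higgs3, (2.16) p.428] -/
theorem disjoint_fiber {i : ℕ} {b b' : V} (hne : b ≠ b') : Disjoint (M.fiber i b) (M.fiber i b') := by
  rw [Finset.disjoint_left]; intro v h1 h2; exact hne ((M.mem_fiber.1 h1).symm.trans (M.mem_fiber.1 h2))

/-- Different blocks have disjoint line sets. [cite: Balaban1983Higgs3, (2.16) p.428] -/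
theorem disjoint_before {i : ℕ} {b b' : V} (hne : b ≠ b') : Disjoint (M.before i b) (M.before i b') := by
  rw [Finset.disjoint_left]; intro l h1 h2; exact hne ((M.mem_before.1 h1).2.symm.trans (M.mem_before.1 h2).2)

/-- The merged block is a component of `G_{i+1}`. [cite: Balaban1983Higgs3, (2.16) p.428] -/
theorem nontriv_succ_bs : M.Nontriv (i + 1) (M.bs i h) :=
  ⟨⟨i, h⟩, by rw [M.before_succ_bs h]; exact Finset.mem_insert_self _ _⟩

/-- Other blocks keep their status. [cite: Balaban1983Higgs3, (2.16) p.428] -/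
theorem nontriv_succ_of_ne {b : V} (hb1 : b ≠ M.bs i h) (hb2 : b ≠ M.bt i h) :
    M.Nontriv (i + 1) b ↔ M.Nontriv i b := by
  unfold Nontriv; rw [M.before_succ_of_ne h hb1 hb2]

/-- The merged vertex carries no η-power. [cite: Balaban1983Higgs3, (2.16) p.428] -/
theorem eAt_succ_bs : M.eAt (i + 1) (M.bs i h) = 0 := by simp [eAt, M.nontriv_succ_bs h]

/-- Other vertices keep their η-power. [cite: Balaban1983Higgs3, (2.16) p.428] -/
theorem eAt_succ_of_ne {b : V} (hb1 : b ≠ M.bs i h) (hb2 : b ≠ M.bt i h) : M.eAt (i + 1) b = M.eAt i b := by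
  simp [eAt, M.nontriv_succ_of_ne h hb1 hb2]

/-- Mass of the merged block (two different blocks). [cite: Balaban1983Higgs3, (2.16) p.428] -/
theorem mass_succ_bs_of_ne (hne : M.bs i h ≠ M.bt i h) :
    M.mass (i + 1) (M.bs i h) = M.mass i (M.bs i h) + M.mass i (M.bt i h) + M.a ⟨i, h⟩ := by
  unfold mass
  rw [M.fiber_succ_bs h, M.before_succ_bs h, Finset.sum_union (M.disjoint_fiber hne),
    Finset.sum_insert (by
      rw [Finset.mem_union, not_or]; exact ⟨M.not_mem_before h _, M.not_mem_before h _⟩),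
    Finset.sum_union (M.disjoint_before hne)]
  ring

/-- Mass of the block after shrinking a loop. [cite: Balaban1983Higgs3, (2.16) p.428] -/
theorem mass_succ_bs_of_loop (heq : M.bs i h = M.bt i h) :
    M.mass (i + 1) (M.bs i h) = M.mass i (M.bs i h) + M.a ⟨i, h⟩ := by
  unfold mass
  rw [M.fiber_succ_bs h, M.before_succ_bs h, ← heq, Finset.union_idempotent, Finset.union_idempotent,
    Finset.sum_insert (M.not_mem_before h _)]
  ring

/-- Mass of the other blocks. [cite: Balaban1983Higgs3, (2.16) p.428] -/
theorem mass_succ_of_ne {b : V} (hb1 : b ≠ M.bs i h) (hb2 : b ≠ M.bt i h) : M.mass (i + 1) b = M.mass i b := by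
  unfold mass; rw [M.fiber_succ_of_ne h hb1 hb2, M.before_succ_of_ne h hb1 hb2]

end Succ

/-- The contribution of a vertex of `G/G_i` to `Σ_α D`: `D` for a component, `0` for an untouched vertex.
[cite: Balaban1983Higgs3, (2.16) p.428] -/
noncomputable def Dpart (i : ℕ) (b : V) : ℝ := if M.Nontriv i b then M.D i b else 0

/-- `Σ_α D = Σ_{vertices of G/G_i} Dpart`. [cite: Balaban1983Higgs3, (2.16) p.428] -/
theorem Dsum_eq (i : ℕ) : M.Dsum i = ∑ b ∈ M.reps i, M.Dpart i b := by
  unfold Dsum Dpart; rw [Finset.sum_filter]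

/-- `Dpart + d + e = mass` for every vertex of `G/G_i`. [cite: Balaban1983Higgs3, (2.16) p.428] -/
theorem Dpart_eq (i : ℕ) {b : V} (hb : b ∈ M.reps i) : M.Dpart i b = M.mass i b - M.d - M.eAt i b := by
  unfold Dpart eAt
  split_ifs with hn
  · rw [M.D_eq]; ring
  · unfold mass
    rw [M.fiber_of_trivial hb hn, Finset.not_nonempty_iff_eq_empty.1 hn]
    simp

/-- p. 427 [PDF 17], the exponent bookkeeping of the shrinking step: *"Now it is easy to see that the remaining powers
of L^jη connected with the graph G₁ give us (L^jη)^{D(G₁)}"*, in the inductive form needed for (2.16): shrinking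
l(i+1) raises `Σ_α D(G_i^{(α)})` by the dimension of the line, the η-power of the kept vertex and — if the endpoints
lie in different blocks — `d` plus the η-power of the removed vertex. KERNEL-CHECKED. [cite: Balaban1983Higgs3, (2.16) p.428] -/
theorem Dsum_succ {i : ℕ} (h : i < m) :
    M.Dsum (i + 1) = M.Dsum i + M.a ⟨i, h⟩ + M.eAt i (M.bs i h)
      + (if M.bs i h = M.bt i h then 0 else (M.d : ℝ) + M.eAt i (M.bt i h)) := by
  rw [M.Dsum_eq, M.Dsum_eq]
  by_cases heq : M.bs i h = M.bt i h
  · rw [if_pos heq, M.reps_succ_of_loop h heq, ← Finset.add_sum_erase _ _ (M.bs_mem_reps h),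
      ← Finset.add_sum_erase (M.reps i) _ (M.bs_mem_reps h)]
    have hrest : ∑ b ∈ (M.reps i).erase (M.bs i h), M.Dpart (i + 1) b
        = ∑ b ∈ (M.reps i).erase (M.bs i h), M.Dpart i b := by
      refine Finset.sum_congr rfl fun b hb => ?_
      have hb1 : b ≠ M.bs i h := (Finset.mem_erase.1 hb).1
      have hb2 : b ≠ M.bt i h := heq ▸ hb1
      have hbi : b ∈ M.reps i := (Finset.mem_erase.1 hb).2
      have hbi' : b ∈ M.reps (i + 1) := by rw [M.reps_succ_of_loop h heq]; exact hbi
      rw [M.Dpart_eq i hbi, M.Dpart_eq (i + 1) hbi', M.mass_succ_of_ne h hb1 hb2, M.eAt_succ_of_ne h hb1 hb2]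
    rw [hrest, M.Dpart_eq (i + 1) (M.bs_mem_reps_succ h), M.Dpart_eq i (M.bs_mem_reps h),
      M.mass_succ_bs_of_loop h heq, M.eAt_succ_bs h]
    ring
  · rw [if_neg heq, M.reps_succ_of_ne h heq]
    have hbs' : M.bs i h ∈ (M.reps i).erase (M.bt i h) := Finset.mem_erase.2 ⟨heq, M.bs_mem_reps h⟩
    rw [← Finset.add_sum_erase _ _ hbs', ← Finset.add_sum_erase (M.reps i) _ (M.bt_mem_reps h),
      ← Finset.add_sum_erase _ _ hbs']
    have hrest : ∑ b ∈ ((M.reps i).erase (M.bt i h)).erase (M.bs i h), M.Dpart (i + 1) b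
        = ∑ b ∈ ((M.reps i).erase (M.bt i h)).erase (M.bs i h), M.Dpart i b := by
      refine Finset.sum_congr rfl fun b hb => ?_
      have hb1 : b ≠ M.bs i h := (Finset.mem_erase.1 hb).1
      have hb2 : b ≠ M.bt i h := (Finset.mem_erase.1 (Finset.mem_erase.1 hb).2).1
      have hbi : b ∈ M.reps i := (Finset.mem_erase.1 (Finset.mem_erase.1 hb).2).2
      have hbi' : b ∈ M.reps (i + 1) := by rw [M.reps_succ_of_ne h heq]; exact Finset.mem_erase.2 ⟨hb2, hbi⟩
      rw [M.Dpart_eq i hbi, M.Dpart_eq (i + 1) hbi', M.mass_succ_of_ne h hb1 hb2, M.eAt_succ_of_ne h hb1 hb2]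
    rw [hrest, M.Dpart_eq (i + 1) (M.bs_mem_reps_succ h), M.Dpart_eq i (M.bs_mem_reps h),
      M.Dpart_eq i (M.bt_mem_reps h), M.mass_succ_bs_of_ne h heq, M.eAt_succ_bs h]
    ring

/-- If every connected component of `G_{i+1}` has positive degree, then `Σ_α D(G_{i+1}^{(α)}) > 0` (there is at least one
component: the one containing l(i+1)) — the form in which the hypothesis of Prop. 2.1 enters the summation over `j`
(*"Because D(G₁) > 0 we can make the summation over j"*, p. 427). [cite: Balaban1983Higgs3, (2.16) p.428] -/
theorem Dsum_succ_pos {i : ℕ} (h : i < m) (hpos : ∀ b ∈ M.reps (i + 1), M.Nontriv (i + 1) b → 0 < M.D (i + 1) b) :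
    0 < M.Dsum (i + 1) := by
  unfold Dsum
  refine Finset.sum_pos (fun b hb => hpos b (Finset.mem_filter.1 hb).1 (Finset.mem_filter.1 hb).2)
    ⟨M.bs i h, Finset.mem_filter.2 ⟨M.bs_mem_reps_succ h, M.nontriv_succ_bs h⟩⟩

/-! ### How the lines at a vertex and `j(v)` change -/

section SuccLow

variable {i : ℕ} (h : i < m)

/-- The lines of `G/G_{i+1}` at an unaffected vertex are those of `G/G_i`. [cite: Balaban1983Higgs3, (2.16) p.428] -/
theorem remAt_succ_of_ne {b : V} (hb1 : b ≠ M.bs i h) (hb2 : b ≠ M.bt i h) : M.remAt (i + 1) b = M.remAt i b := by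
  ext l
  rw [M.mem_remAt, M.mem_remAt, M.rep_succ h, M.rep_succ h]
  have hρ : ∀ x : V, M.rho i h x = b ↔ x = b := by
    intro x; unfold rho; split_ifs with hx
    · exact ⟨fun e => absurd e.symm hb1, fun e => absurd (hx.symm.trans e) hb2.symm⟩
    · exact Iff.rfl
  rw [hρ, hρ]
  constructor
  · rintro ⟨hl, hr⟩; exact ⟨(Nat.le_succ i).trans hl, hr⟩
  · rintro ⟨hl, hr⟩
    refine ⟨?_, hr⟩
    rcases Nat.lt_or_eq_of_le hl with hlt | heq
    · exact hlt
    · exfalso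
      have : l = ⟨i, h⟩ := Fin.ext heq.symm
      subst this
      rcases hr with hr | hr
      · exact hb1 hr.symm
      · exact hb2 hr.symm

/-- … hence `j(b)` is unchanged there. [cite: Balaban1983Higgs3, (2.16) p.428] -/
theorem low_succ_of_ne {b : V} (hb1 : b ≠ M.bs i h) (hb2 : b ≠ M.bt i h) (j : Fin m → ℕ) (k : ℕ) :
    M.low (i + 1) b j k = M.low i b j k := by
  unfold low; simp_rw [M.remAt_succ_of_ne h hb1 hb2]

/-- l(i+1) is a line at `b_s`. [cite: Balaban1983Higgs3, (2.16) p.428] -/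
theorem mem_remAt_bs : (⟨i, h⟩ : Fin m) ∈ M.remAt i (M.bs i h) := M.mem_remAt.2 ⟨le_rfl, Or.inl rfl⟩

/-- l(i+1) is a line at `b_t`. [cite: Balaban1983Higgs3, (2.16) p.428] -/
theorem mem_remAt_bt : (⟨i, h⟩ : Fin m) ∈ M.remAt i (M.bt i h) := M.mem_remAt.2 ⟨le_rfl, Or.inr rfl⟩

variable {j : Fin m → ℕ} {k : ℕ} (hj : Monotone j) (hjk : ∀ l, j l < k)
include hj hjk

/-- p. 427: *"The index j of the line is the lowest index among J(l̃)"* — for `j ∈ J(l̃)` (monotone along the order),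
`j(b_s) = j_{l(i+1)}`. [cite: Balaban1983Higgs3, (2.15) p.427] -/
theorem low_bs : M.low i (M.bs i h) j k = j ⟨i, h⟩ :=
  M.low_eq_of_forall (M.mem_remAt_bs h) (hjk _).le fun l' hl' =>
    hj (Fin.le_iff_val_le_val.2 (by simpa using (M.mem_remAt.1 hl').1))

/-- … and `j(b_t) = j_{l(i+1)}`. [cite: Balaban1983Higgs3, (2.15) p.427] -/
theorem low_bt : M.low i (M.bt i h) j k = j ⟨i, h⟩ :=
  M.low_eq_of_forall (M.mem_remAt_bt h) (hjk _).le fun l' hl' =>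
    hj (Fin.le_iff_val_le_val.2 (by simpa using (M.mem_remAt.1 hl').1))

/-- After shrinking l(i+1), every `j(b)` of `G/G_{i+1}` is `≥ j_{l(i+1)}`. [cite: Balaban1983Higgs3, (2.16) p.428] -/
theorem le_low_succ (b : V) : j ⟨i, h⟩ ≤ M.low (i + 1) b j k :=
  M.le_low_iff.2 ⟨(hjk _).le, fun l' hl' =>
    hj (Fin.le_iff_val_le_val.2 (by have := (M.mem_remAt.1 hl').1; simp only; omega))⟩

end SuccLow

/-! ## The weight (2.14) of `G/G_i` on the concrete cubes -/

section Weight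

variable (i k : ℕ) (j : Fin m → ℕ) (box : V → Fin M.d → ℕ)

/-- The decay rate of the exponential factors at stage `i`: `δ_i = δ₀/(2m+1)^i` (p. 428: *"δ_{i+1} … is positive and
depends on δ₁, n̄"*). [cite: Balaban1983Higgs3, (2.16) p.428] -/
noncomputable def δAt (i : ℕ) : ℝ := M.δ₀ / (2 * m + 1) ^ i

/-- The unit cube `□(v)` of the vertex `v` (scale `k`, side `L^kη = 1`). [cite: Balaban1983Higgs3, (2.14) p.426] -/
def unit (v : V) : Cube M.d := ⟨k, box v⟩

/-- The admissible localizations of one vertex of `G/G_i`: *"cubes Δ(v) of the size L^{j(v)}η"*, `Δ(v) ⊂ □(v)`; a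
non-representative carries the dummy value `□(v)`. [cite: Balaban1983Higgs3, (2.14) p.426] -/
def locF (v : V) : Finset (Cube M.d) :=
  if M.rep i v = v then Cube.desc M.L (M.unit k box v) (M.low i v j k) else {M.unit k box v}

/-- The finite family `{Δ(v)}_{v ∈ G/G_i}` of localizations summed over in (2.15)/(2.16).
[cite: Balaban1983Higgs3, (2.15) p.427] -/
def Locs : Finset (V → Cube M.d) := Fintype.piFinset (M.locF i k j box)

/-- The vertex factors of (2.14) for `G/G_i`: `Π_{v} (L^{j(v)}η)^{d + e(v)}`. [cite: Balaban1983Higgs3, (2.14) p.427] -/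
noncomputable def VF : ℝ := ∏ b ∈ M.reps i, M.sc k (M.low i b j k) ^ ((M.d : ℝ) + M.eAt i b)

/-- The line powers of (2.14) for `G/G_i`: `Π_{l} (L^{j_l}η)^{a_l}`. [cite: Balaban1983Higgs3, (2.14) p.427] -/
noncomputable def LP : ℝ := ∏ l ∈ remLines m i, M.sc k (j l) ^ M.a l

/-- One exponential factor of (2.14) for `G/G_i` at decay rate `δ_i`: `exp[−δ_i (L^{j_l}η)^{−1} dist(Δ(v_l), Δ(v′_l))]`
(η-units: `(L^{j_l}η)^{−1} · η · distI = distI/L^{j_l}`). [cite: Balaban1983Higgs3, (2.14) p.427] -/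
noncomputable def lineF (Θ : V → Cube M.d) (l : Fin m) : ℝ :=
  Real.exp (-(M.δAt i * (Cube.distI M.L (Θ (M.rep i (M.src l))) (Θ (M.rep i (M.tgt l))) : ℝ) / (M.L : ℝ) ^ j l))

/-- The exponential factors of (2.14) for `G/G_i`. [cite: Balaban1983Higgs3, (2.14) p.427] -/
noncomputable def EXP (Θ : V → Cube M.d) : ℝ := ∏ l ∈ remLines m i, M.lineF i j Θ l

/-- **(2.14)/(2.16)** p. 427–428: the weight sum `Σ_{{Δ(v)}_{v∈G/G_i}} Ẽ(G/G_i(j), {Δ(v)})` of the quotient graph at stage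
`i` (at `i = 0`: (2.14) for `G` itself with decay rate `δ₀ = ½δ₁`). [cite: Balaban1983Higgs3, (2.16) p.428] -/
noncomputable def W : ℝ := ∑ Θ ∈ M.Locs i k j box, M.VF i k j * M.LP i k j * M.EXP i j Θ

end Weight

end Model

end Literature.MathematicalPhysics.QuantumFieldTheory.Balaban1983to89.B3Ineq215
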